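import Mathlib
import Summits.NavierStokesRegularity.NavierStokesRegularity.Theorems.EulerZoomLiouvillePowerGaugeEulerLiouvilleSelfSimilarTopBadNodeArcTools
import HarnessLib.Audit

/-!
# Rung C1 of the crux `EulerZoomLiouville.PowerGaugeEulerLiouville`: spectral data of the linearisation at a
# degenerate bad non-vortical node

Route №10 `EulerZoomLiouville` (NavierStokesRegularity), crux E = stmt-NavierStokesRegularity-19832,
tenure rung C1 (exactly self-similar members), registered residue `stub_selfSimilarExtremal`.
Tenth file of the NODAL-CONTINUUM line (lineage ns-typeII-p1, gen 7): the eigen-data used by the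
stagnation-arc exit analysis (`…SelfSimilarTopBadNodeArc`).  For a `C²` self-similar Euler profile
(`0 < γ < ½`), a point `z` with `curl U(z) = 0` and a unit stretching rate `≥ 1`, and a unit kernel vector
`e` of `A = DV(z) = γI + DU(z)`:

* `exists_spectralData_of_badNode` — an orthonormal eigenbasis `b` of the symmetric `A` with
  eigenvalues `a`, constants `0 < μ ≤ α` with `a_i ≤ α`, `a_i ≥ μ` on the positive indices, and on the
  non-positive indices `a_i ≤ −μ` OR the coordinate of any `ξ ⊥ e` vanishes (the kernel of `A` is the
  line `ℝe`, `kernel_coord_eq_zero_of_top`, since `tr A = 3γ < 1 + γ ≤` top eigenvalue).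

WHAT THIS IS NOT: not NS, not E — linear-algebra bookkeeping. References: P. Constantin, M. Ignatova,
V. Vicol, arXiv:2602.17570 (2026), §3.5. [ConstantinIgnatovaVicol2026Putative]
-/

noncomputable section

-- flat `Theorems/<Route><Decl>…` files of one crux share the namespace of the crux (tree convention)
set_option linter.dupNamespace false

open Set Filter Topology Metric Function InnerProductSpace
open scoped RealInnerProductSpace NNReal

namespace Summit.NavierStokesRegularity.NavierStokesRegularity.Theorems.PowerGaugeEulerLiouville.NodalContinuum

open Literature.Analysis Literature.Analysis.FluidPDE Literature.Analysis.ODE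
open Summit.NavierStokesRegularity.NavierStokesRegularity.Theorems.PowerGaugeEulerLiouville.NodalFiniteness

variable {γ : ℝ} {c : EuclideanSpace ℝ (Fin 3)}
  {U : EuclideanSpace ℝ (Fin 3) → EuclideanSpace ℝ (Fin 3)} {P : EuclideanSpace ℝ (Fin 3) → ℝ}

/-- `DV(z) = γI + DU(z)` is symmetric at a point with `curl U(z) = 0`. [cite: ConstantinIgnatovaVicol2026Putative, §3.5 proof of Prop 3.9] -/
theorem isSymmetric_fderiv_transport_of_curl_eq_zero (h : IsSelfSimilarEulerProfile γ c U P)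
    {z : EuclideanSpace ℝ (Fin 3)} (hΩz : curl U z = 0) :
    ((fderiv ℝ (selfSimilarTransport γ c U) z :
      EuclideanSpace ℝ (Fin 3) →L[ℝ] EuclideanSpace ℝ (Fin 3)) :
      EuclideanSpace ℝ (Fin 3) →ₗ[ℝ] EuclideanSpace ℝ (Fin 3)).IsSymmetric := by
  have hDV := fderiv_transport_eq h z
  have hSU := isSymmetric_fderiv_of_curl_eq_zero (h.differentiable_velocity z) hΩz
  rw [hDV]
  intro x y
  have hSxy := hSU x y
  simp only [ContinuousLinearMap.coe_coe] at hSxy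
  simp only [ContinuousLinearMap.coe_coe, add_apply,
    FunLike.coe_smul, Pi.smul_apply, ContinuousLinearMap.id_apply,
    inner_add_left, inner_add_right, real_inner_smul_left, real_inner_smul_right]
  rw [hSxy]

/-- **Spectral data at a degenerate bad non-vortical node** (`γ < ½`): for `z` with `curl U(z) = 0`, a
unit `w` with `⟪DU(z)w, w⟫ ≥ 1`, and a unit `e` with `DV(z)e = 0`, there are an orthonormal eigenbasis
`b` of `A = DV(z)` with eigenvalues `a` and constants `0 < μ ≤ α` such that `a_i ≤ α` for all `i`,
`a_i ≥ μ` whenever `a_i > 0`, and for every `ξ ⊥ e` and every `i` with `a_i ≤ 0`: `a_i ≤ −μ` or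
`⟪b i, ξ⟫ = 0` (the kernel of `A` is `ℝe`: `tr A = 3γ < 1+γ ≤ ⟪Aw, w⟫`).
[cite: ConstantinIgnatovaVicol2026Putative, §3.5 Thms 3.8–3.10 (linear algebra at a node; not in print)] -/
theorem exists_spectralData_of_badNode (h : IsSelfSimilarEulerProfile γ c U P) (hγ : 0 < γ)
    (hγ2 : γ < 1 / 2) {z : EuclideanSpace ℝ (Fin 3)} (hΩz : curl U z = 0)
    (hbad : ∃ w : EuclideanSpace ℝ (Fin 3), ‖w‖ = 1 ∧ 1 ≤ ⟪fderiv ℝ U z w, w⟫)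
    {e : EuclideanSpace ℝ (Fin 3)} (he1 : ‖e‖ = 1)
    (hAe : fderiv ℝ (selfSimilarTransport γ c U) z e = 0) :
    ∃ (b : OrthonormalBasis (Fin 3) ℝ (EuclideanSpace ℝ (Fin 3))) (a : Fin 3 → ℝ) (μ α : ℝ),
      (∀ i, fderiv ℝ (selfSimilarTransport γ c U) z (b i) = a i • b i) ∧ 0 < μ ∧ μ ≤ α ∧
      (∀ i, a i ≤ α) ∧ (∀ i, 0 < a i → μ ≤ a i) ∧
      ∀ ξ : EuclideanSpace ℝ (Fin 3), ⟪e, ξ⟫ = 0 → ∀ i, ¬ 0 < a i → a i ≤ -μ ∨ ⟪b i, ξ⟫ = 0 := by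
  classical
  set A : EuclideanSpace ℝ (Fin 3) →L[ℝ] EuclideanSpace ℝ (Fin 3) :=
    fderiv ℝ (selfSimilarTransport γ c U) z with hAdef
  have hDV : A = γ • ContinuousLinearMap.id ℝ _ + fderiv ℝ U z := fderiv_transport_eq h z
  have hA : (A : EuclideanSpace ℝ (Fin 3) →ₗ[ℝ] EuclideanSpace ℝ (Fin 3)).IsSymmetric :=
    isSymmetric_fderiv_transport_of_curl_eq_zero h hΩz
  have hAe' : A e = 0 := hAe
  have hn : Module.finrank ℝ (EuclideanSpace ℝ (Fin 3)) = 3 := by simp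
  set b := hA.eigenvectorBasis hn with hbdef
  set a : Fin 3 → ℝ := hA.eigenvalues hn with hadef
  have hb : ∀ i, A (b i) = a i • b i := fun i => hA.apply_eigenvectorBasis hn i
  have hsum : ∑ i, a i < 1 + γ := by
    have htr := hA.trace_eq_sum_eigenvalues hn
    have hdiv : LinearMap.trace ℝ _ (fderiv ℝ U z :
        EuclideanSpace ℝ (Fin 3) →ₗ[ℝ] EuclideanSpace ℝ (Fin 3)) = 0 := h.divFree z
    have h3 : LinearMap.trace ℝ _ (A : EuclideanSpace ℝ (Fin 3) →ₗ[ℝ] EuclideanSpace ℝ (Fin 3)) =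
        3 * γ := by
      rw [hDV, ContinuousLinearMap.toLinearMap_add, ContinuousLinearMap.toLinearMap_smul, map_add,
        map_smul, hdiv, ContinuousLinearMap.coe_id, LinearMap.trace_id, finrank_euclideanSpace,
        Fintype.card_fin]
      norm_num
      ring
    have : ∑ i, a i = 3 * γ := by
      rw [← h3, htr]
      simp [hadef]
    rw [this]; linarith only [hγ2]
  obtain ⟨w, hw1, hw⟩ := hbad
  have hAw : 1 + γ ≤ ⟪A w, w⟫ := by
    rw [hDV]
    simp only [add_apply, FunLike.coe_smul, Pi.smul_apply, ContinuousLinearMap.id_apply,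
      inner_add_left, real_inner_smul_left, real_inner_self_eq_norm_sq, hw1]
    linarith only [hw]
  obtain ⟨i₀, hi₀, huniq, hker⟩ := kernel_coord_eq_zero_of_top hA b hb (by linarith : (0 : ℝ) < 1 + γ)
    hsum ⟨w, hw1, hAw⟩ he1 hAe'
  -- top index `j ≠ i₀`, so `univ.erase i₀` is nonempty
  obtain ⟨j, -, hj⟩ := Finset.exists_max_image Finset.univ a Finset.univ_nonempty
  have hajpos : 0 < a j := by
    have htop : ⟪A w, w⟫ ≤ a j := by
      rw [inner_apply_self_eq_sum_eigen hA b hb w]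
      calc ∑ i, a i * ⟪b i, w⟫ ^ 2 ≤ ∑ i, a j * ⟪b i, w⟫ ^ 2 :=
            Finset.sum_le_sum fun i _ => mul_le_mul_of_nonneg_right (hj i (Finset.mem_univ _))
              (sq_nonneg _)
        _ = a j := by rw [← Finset.mul_sum, b.sum_sq_inner_right, hw1]; ring
    linarith only [htop, hAw, hγ]
  have hji₀ : j ≠ i₀ := by rintro rfl; rw [hi₀] at hajpos; exact lt_irrefl _ hajpos
  obtain ⟨i₁, hi₁mem, hi₁⟩ := Finset.exists_min_image (Finset.univ.erase i₀) (fun i => |a i|)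
    ⟨j, Finset.mem_erase.2 ⟨hji₀, Finset.mem_univ _⟩⟩
  obtain ⟨i₂, -, hi₂⟩ := Finset.exists_max_image Finset.univ (fun i => |a i|) Finset.univ_nonempty
  set μ : ℝ := |a i₁| with hμdef
  set α : ℝ := |a i₂| with hαdef
  have hμpos : 0 < μ := abs_pos.2 (huniq i₁ (Finset.mem_erase.1 hi₁mem).1)
  have hμle : ∀ i, i ≠ i₀ → μ ≤ |a i| := fun i hi => hi₁ i (Finset.mem_erase.2 ⟨hi, Finset.mem_univ _⟩)
  have hαge : ∀ i, a i ≤ α := fun i => (le_abs_self _).trans (hi₂ i (Finset.mem_univ _))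
  have hμα : μ ≤ α := hi₂ i₁ (Finset.mem_univ _)
  have hαpos : 0 < α := lt_of_lt_of_le hμpos hμα
  have hpos_i : ∀ i, 0 < a i → μ ≤ a i := by
    intro i hi
    have hne : i ≠ i₀ := by rintro rfl; rw [hi₀] at hi; exact lt_irrefl _ hi
    have := hμle i hne; rwa [abs_of_pos hi] at this
  have hneg_i : ∀ ξ : EuclideanSpace ℝ (Fin 3), ⟪e, ξ⟫ = 0 →
      ∀ i, ¬ 0 < a i → a i ≤ -μ ∨ ⟪b i, ξ⟫ = 0 := by
    intro ξ hξ i hi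
    by_cases hii : i = i₀
    · exact Or.inr (hii ▸ hker ξ hξ)
    · left
      have hlt : a i < 0 := lt_of_le_of_ne (not_lt.1 hi) (huniq i hii)
      have := hμle i hii; rw [abs_of_neg hlt] at this; linarith only [this]
  exact ⟨b, a, μ, α, hb, hμpos, hμα, hαge, hpos_i, hneg_i⟩

end Summit.NavierStokesRegularity.NavierStokesRegularity.Theorems.PowerGaugeEulerLiouville.NodalContinuum
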